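import Mathlib
import HarnessLib
import Summits.ValiantsHypothesis.ValiantsHypothesis.Theses.MonotoneRestoration
import Literature.Computability.AlgebraicComplexity.ArithCircuit
import Literature.Computability.AlgebraicComplexity.ArithCircuitProofs
import Literature.Computability.AlgebraicComplexity.MonotoneStructure
import Literature.Computability.AlgebraicComplexity.PermanentIrreducible
import Literature.ModelTheory.FiniteModelTheory.CkEquiv
import Summits.ValiantsHypothesis.ValiantsHypothesis.Theorems.MonotoneRestorationMonotoneRestorationQPCosetCount
import Summits.ValiantsHypothesis.ValiantsHypothesis.Theorems.MonotoneRestorationMonotoneRestorationQPSymmetricLB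
import Summits.ValiantsHypothesis.ValiantsHypothesis.Theorems.MonotoneRestorationMonotoneRestorationQPSupportSymmetrisation
import Summits.ValiantsHypothesis.ValiantsHypothesis.Theorems.MonotoneRestorationMonotoneRestorationQPSparseRegime
import Summits.ValiantsHypothesis.ValiantsHypothesis.Theorems.MonotoneRestorationMonotoneRestorationQPBeta
import Literature.Computability.AlgebraicComplexity.SymmetricArithCircuit
import Literature.Computability.AlgebraicComplexity.DawarWilsenach2025Proofs
import Literature.GroupTheory.PermutationGroups.SmallIndexSubgroups
import Summits.ValiantsHypothesis.ValiantsHypothesis.Theorems.MonotoneRestorationQP.Negative.LoadBearing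
import Summits.ValiantsHypothesis.ValiantsHypothesis.Theorems.MonotoneRestorationMonotoneRestorationQPPermSupportCount

/-! # TTRL-lite variant V20280 of `MonotoneRestorationQP` / `stub_esymmRowSums_complexity` (stmt-ValiantsHypothesis-15886)

Machine-generated helper (proved); move `lemma_proposal`, op `llm`: SIZE BOOKKEEPING of the landed proof, isolated: rows n(n+1) + DP start 2 + DP 2dn ≤ (n+2)³ whenever d ≤ n (target: d = n/2 ≤ n by `Nat.div_le_self`). Pure ℕ arithmetic, cheapest anchor of the batch. C.
See docs/architecture/ttrl-lite.md. -/

namespace Summit.ValiantsHypothesis.ValiantsHypothesis.Theorems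

open Summit.ValiantsHypothesis.ValiantsHypothesis.Theses.MonotoneRestoration
open Literature.Computability.AlgebraicComplexity

/-- TTRL-lite variant V20280 (lemma_proposal `llm`) of `stub_esymmRowSums_complexity` (stmt-ValiantsHypothesis-15886); machine-found, kernel-checked. -/
theorem stub_esymmRowSums_complexity_var20280 :
    ∀ n d : ℕ, d ≤ n → n * (n + 1) + 2 + 2 * d * n ≤ (n + 2) ^ 3 := by
  intro n d h0
  nlinarith [sq_nonneg (n - d), sq_nonneg (n + d), sq_nonneg n, sq_nonneg d, mul_nonneg (sq_nonneg n) (sq_nonneg d)]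

end Summit.ValiantsHypothesis.ValiantsHypothesis.Theorems
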